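import Summits.AtomisticToContinuum.Crystallization.Theses.HolmgrenBoyleLind

/-!
# `FLCEquilibriumPeriodic` (route `HolmgrenBoyleLind`): the glue, in both directions

Support file for item stmt-AtomisticToContinuum-6079 (`FLCEquilibriumPeriodic`: every
`δ`-separated, `r`-dense subset of `ℝ³` of finite local complexity in exact Lennard-Jones force
balance is the point set of a periodic configuration).

* `flcEquilibriumPeriodic_of_uc_of_hsr` — the route's intended glue
  `HalfSpaceUniqueContinuation → HalfSpaceRigidityPeriodic → FLCEquilibriumPeriodic`
  (item 6075 → item 6077 → item 6079): `UC(Λ)` is literally the last hypothesis of `HSR(Λ)`.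
* `halfSpaceUniqueContinuation_of_flcEquilibriumPeriodic` — the converse
  `FLCEquilibriumPeriodic → HalfSpaceUniqueContinuation`, unconditionally: the patch-hull of the
  point set of a periodic configuration consists of its translates
  (`hbl_exists_hull_eq_translate`), and two translates that agree on a closed ball of radius a
  covering radius of the lattice of periods — in particular on an open half-space — agree
  everywhere (`hbl_translate_agree_of_agree_on_ball`).
* `flcEquilibriumPeriodic_iff_halfSpaceUniqueContinuation` — hence, granted
  `HalfSpaceRigidityPeriodic` (item 6077, Boyle–Lind transcribed), the support item 6079 is
  EQUIVALENT to the crux `HalfSpaceUniqueContinuation` (item 6075): it cannot close before the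
  crux does.

Pure logic and lattice bookkeeping (`ZSpan.floor` / `ZSpan.norm_fract_le` give the covering
radius `∑ ‖bᵢ‖` of a `ℤ`-basis); nothing here uses the Lennard-Jones potential.
-/

namespace Summit.AtomisticToContinuum.Crystallization.Theorems

open Literature.MathematicalPhysics.StatisticalMechanics
open Summit.AtomisticToContinuum.Crystallization.Theses.HolmgrenBoyleLind

/-! ## Forward glue -/

/-- The route's glue `UC → HSR → FLCEquilibriumPeriodic` (items 6075 → 6077 → 6079): for an FLC
Delone set `Λ` in force balance, `HalfSpaceUniqueContinuation` applied to `Λ` is exactly the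
half-space-rigidity hypothesis of `HalfSpaceRigidityPeriodic`, whose conclusion is the claim.
[folklore] -/
theorem flcEquilibriumPeriodic_of_uc_of_hsr (hUC : HalfSpaceUniqueContinuation)
    (hHSR : HalfSpaceRigidityPeriodic) : FLCEquilibriumPeriodic := by
  intro Λ δ r hδ hr hsep hden hFLC hbal
  exact hHSR Λ δ r hδ hr hsep hden hFLC (hUC Λ δ r hδ hr hsep hden hFLC hbal)

/-! ## Periodic configurations: covering radius, translates, patch-hull -/

section Periodic

variable {d : ℕ} (P : PeriodicConfiguration d)

/-- **Covering radius.** The lattice of periods of a periodic configuration is relatively dense: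
there is `ρ` such that every point of `ℝᵈ` is within `ρ` of a lattice vector (take a `ℤ`-basis
`b` of the full-rank lattice; `p - ⌊p⌋_b = fract_b p` has norm `≤ ∑ ‖bᵢ‖`). [folklore] -/
theorem hbl_exists_norm_sub_lattice_le :
    ∃ ρ : ℝ, ∀ p : EuclideanSpace ℝ (Fin d), ∃ g ∈ P.lattice, ‖p - g‖ ≤ ρ := by
  classical
  let b₀ := Module.Free.chooseBasis ℤ P.lattice
  let b := b₀.ofZLatticeBasis ℝ P.lattice
  refine ⟨∑ i, ‖b i‖, fun p => ⟨(ZSpan.floor b p : EuclideanSpace ℝ (Fin d)), ?_, ?_⟩⟩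
  · exact (b₀.ofZLatticeBasis_span ℝ).le (ZSpan.floor b p).2
  · simpa [ZSpan.fract_apply] using ZSpan.norm_fract_le b p

/-- Two translates `P.points - v` and `P.points - v'` of the point set of a periodic configuration
that agree on a closed ball `B̄(c, ρ)`, `ρ` a covering radius of the lattice of periods, agree
everywhere: move any `z` into the ball by a period. [folklore] -/
theorem hbl_translate_agree_of_agree_on_ball {ρ : ℝ}
    (hρ : ∀ p : EuclideanSpace ℝ (Fin d), ∃ g ∈ P.lattice, ‖p - g‖ ≤ ρ)
    (c v v' : EuclideanSpace ℝ (Fin d))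
    (h : ∀ z : EuclideanSpace ℝ (Fin d), dist z c ≤ ρ → (z + v ∈ P.points ↔ z + v' ∈ P.points))
    (z : EuclideanSpace ℝ (Fin d)) : z + v ∈ P.points ↔ z + v' ∈ P.points := by
  obtain ⟨g, hg, hgρ⟩ := hρ (z - c)
  have hzc : dist (z - g) c ≤ ρ := by
    have e : z - g - c = z - c - g := by abel
    rw [dist_eq_norm, e]
    exact hgρ
  have hneg : -g ∈ P.lattice := P.lattice.neg_mem hg
  -- shifting the test point by the period `g`
  have shift : ∀ w : EuclideanSpace ℝ (Fin d), z + w ∈ P.points ↔ z - g + w ∈ P.points := by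
    intro w
    constructor
    · intro hz
      have e : z - g + w = z + w + -g := by abel
      rw [e]
      exact P.add_mem_points hz hneg
    · intro hz
      have e : z + w = z - g + w + g := by abel
      rw [e]
      exact P.add_mem_points hz hg
  rw [shift v, shift v']
  exact h (z - g) hzc

/-- Reading a patch identity `{z ∈ ω, ‖z‖ ≤ R} = {z + v ∈ P.points, ‖z‖ ≤ R}` at a point of
norm `≤ R`. [folklore] -/
theorem hbl_mem_iff_of_patch_eq {S T : Set (EuclideanSpace ℝ (Fin d))} {R : ℝ}
    (hST : {z : EuclideanSpace ℝ (Fin d) | z ∈ S ∧ ‖z‖ ≤ R} =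
      {z : EuclideanSpace ℝ (Fin d) | z ∈ T ∧ ‖z‖ ≤ R})
    {y : EuclideanSpace ℝ (Fin d)} (hy : ‖y‖ ≤ R) : y ∈ S ↔ y ∈ T := by
  have h := Set.ext_iff.1 hST y
  simp only [Set.mem_setOf_eq] at h
  exact ⟨fun hS => ((h.1 ⟨hS, hy⟩).1), fun hT => ((h.2 ⟨hT, hy⟩).1)⟩

/-- **The patch-hull of a crystal consists of its translates.** If every closed ball of `ω`
about `0` is an exact translate of a patch of `P.points` (patch-hull membership as inlined in the
route `HolmgrenBoyleLind`), then `ω = P.points - v` for one `v`: the translates realising the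
`R`-patches for `R ≥ ρ` all agree with the one realising the `ρ`-patch on `B̄(0, ρ)`, hence
everywhere. [folklore] -/
theorem hbl_exists_hull_eq_translate {ω : Set (EuclideanSpace ℝ (Fin d))}
    (hω : ∀ R : ℝ, ∃ v : EuclideanSpace ℝ (Fin d),
      {z : EuclideanSpace ℝ (Fin d) | z ∈ ω ∧ ‖z‖ ≤ R} =
        {z : EuclideanSpace ℝ (Fin d) | z + v ∈ P.points ∧ ‖z‖ ≤ R}) :
    ∃ v : EuclideanSpace ℝ (Fin d), ω = {z : EuclideanSpace ℝ (Fin d) | z + v ∈ P.points} := by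
  obtain ⟨ρ, hρ⟩ := hbl_exists_norm_sub_lattice_le P
  obtain ⟨v₀, hv₀⟩ := hω ρ
  refine ⟨v₀, Set.ext fun z => ?_⟩
  obtain ⟨w, hw⟩ := hω (max ρ ‖z‖)
  -- the translates by `w` and by `v₀` agree on `B̄(0, ρ)`, hence everywhere
  have hagree : ∀ y : EuclideanSpace ℝ (Fin d), dist y 0 ≤ ρ →
      (y + w ∈ P.points ↔ y + v₀ ∈ P.points) := by
    intro y hy
    rw [dist_zero_right] at hy
    have e1 := hbl_mem_iff_of_patch_eq (T := {z | z + w ∈ P.points}) hw (hy.trans (le_max_left _ _))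
    have e2 := hbl_mem_iff_of_patch_eq (T := {z | z + v₀ ∈ P.points}) hv₀ hy
    simp only [Set.mem_setOf_eq] at e1 e2
    exact e1.symm.trans e2
  have hall := hbl_translate_agree_of_agree_on_ball P hρ 0 w v₀ hagree z
  have e3 := hbl_mem_iff_of_patch_eq (T := {z | z + w ∈ P.points}) hw (le_max_right ρ ‖z‖)
  simp only [Set.mem_setOf_eq] at e3 ⊢
  exact e3.trans hall

/-- A closed ball inside an open half-space `{z | ⟪z, u⟫ < a}` (`u ≠ 0`): the ball of radius `ρ`
about `c = t • u`, `t = (a - 1 - ρ‖u‖)/‖u‖²`. [folklore] -/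
theorem hbl_inner_lt_of_dist_le {u : EuclideanSpace ℝ (Fin d)} (hu : u ≠ 0) (a ρ : ℝ)
    {z : EuclideanSpace ℝ (Fin d)}
    (hz : dist z (((a - 1 - ρ * ‖u‖) / ‖u‖ ^ 2) • u) ≤ ρ) : inner ℝ z u < a := by
  set t : ℝ := (a - 1 - ρ * ‖u‖) / ‖u‖ ^ 2 with ht
  have hu0 : 0 < ‖u‖ := norm_pos_iff.2 hu
  have hu2 : (‖u‖ ^ 2 : ℝ) ≠ 0 := by positivity
  have h1 : inner ℝ z u = inner ℝ (z - t • u) u + t * ‖u‖ ^ 2 := by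
    rw [inner_sub_left, real_inner_smul_left, real_inner_self_eq_norm_sq]
    ring
  have h2 : inner ℝ (z - t • u) u ≤ ρ * ‖u‖ := by
    calc inner ℝ (z - t • u) u ≤ ‖z - t • u‖ * ‖u‖ := real_inner_le_norm _ _
      _ ≤ ρ * ‖u‖ := by
        refine mul_le_mul_of_nonneg_right ?_ hu0.le
        rwa [dist_eq_norm] at hz
  have h3 : t * ‖u‖ ^ 2 = a - 1 - ρ * ‖u‖ := by
    rw [ht, div_mul_cancel₀ _ hu2]
  linarith

end Periodic

/-! ## Converse glue and the equivalence -/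

/-- **`FLCEquilibriumPeriodic → HalfSpaceUniqueContinuation`** (item 6079 implies the crux 6075,
unconditionally): if the FLC Delone equilibrium `Λ` is `P.points`, two elements of its patch-hull
are translates `P.points - v`, `P.points - v'`; an open half-space contains a closed ball of
radius a covering radius of the lattice of periods, agreement there propagates by periods to
all of `ℝ³`, so the two hull elements coincide. [folklore] -/
theorem halfSpaceUniqueContinuation_of_flcEquilibriumPeriodic (h : FLCEquilibriumPeriodic) :
    HalfSpaceUniqueContinuation := by
  intro Λ δ r hδ hr hsep hden hFLC hbal ω ω' hω hω' u a hu hagree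
  obtain ⟨P, hP⟩ := h Λ δ r hδ hr hsep hden hFLC hbal
  subst hP
  obtain ⟨v, rfl⟩ := hbl_exists_hull_eq_translate P hω
  obtain ⟨v', rfl⟩ := hbl_exists_hull_eq_translate P hω'
  obtain ⟨ρ, hρ⟩ := hbl_exists_norm_sub_lattice_le P
  have hball : ∀ z : EuclideanSpace ℝ (Fin 3),
      dist z (((a - 1 - ρ * ‖u‖) / ‖u‖ ^ 2) • u) ≤ ρ →
        (z + v ∈ P.points ↔ z + v' ∈ P.points) := fun z hz => by
    simpa only [Set.mem_setOf_eq] using hagree z (hbl_inner_lt_of_dist_le hu a ρ hz)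
  ext z
  simpa only [Set.mem_setOf_eq] using hbl_translate_agree_of_agree_on_ball P hρ _ v v' hball z

/-- Granted `HalfSpaceRigidityPeriodic` (item 6077), the support item `FLCEquilibriumPeriodic`
(6079) is equivalent to the crux `HalfSpaceUniqueContinuation` (6075). [folklore] -/
theorem flcEquilibriumPeriodic_iff_halfSpaceUniqueContinuation (hHSR : HalfSpaceRigidityPeriodic) :
    FLCEquilibriumPeriodic ↔ HalfSpaceUniqueContinuation :=
  ⟨halfSpaceUniqueContinuation_of_flcEquilibriumPeriodic,
    fun hUC => flcEquilibriumPeriodic_of_uc_of_hsr hUC hHSR⟩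

end Summit.AtomisticToContinuum.Crystallization.Theorems
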